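import Mathlib
import HarnessLib
import Summits.Ventures.LatticeQCDFlow.Exactness.KickAngleMap

/-!
# The single-site leading-order kick on the sphere is a rotation towards the local field by the arc `κ sin θ'`: it fixes the azimuth, moves the polar angle by `kickAngle κ`, stays on the sphere, and is not injective for `κ > 1`

HONEST FRAMING: exact (Metropolis-corrected) sampling algorithms for lattice gauge theory;
figures of merit are autocorrelation/cost numbers at stated couplings and volumes; no
continuum-physics claim.

Venture `LatticeQCDFlow` (cell pub-lqcd), topic `Exactness`; FANOUT row 7 (`s0-cpn-null`: the
S0-D1 rung — 2D CP⁹, Lüscher's LO trivializing map inside HMC, Engel–Schaefer 2011).  NEW WORK of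
the cell over Mathlib (real inner product spaces, `InnerProductGeometry.angle`) and the tree's
`Exactness/KickAngleMap.lean` (`kickAngle κ θ = θ − κ sin θ`, its range on `[0, π]`, the fold for
`κ > 1`); nothing is cited as a fact.  Printed counterparts, NAMED ONLY: Engel–Schaefer, Comput.
Phys. Commun. 182 (2011) 2107, §3 eq. (17) (the site update `p = (1 − x'x'ᵀ)J`, `α = ε_s c |p|`,
`x = cos α x' + sin α p/|p|`) and eq. (18) (its Jacobian in the two printed forms
`(1 − ε_s c J·x')(cos α − (J·x'/|p|) sin α)^{2N−2} = (dθ/dθ')(sin θ/sin θ')^{2N−2}`).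

## Setting

`V` a real inner product space (for CP(N−1): `ℝ^{2N} ≅ ℂ^N`, the site variable a unit vector
`x' ∈ S^{2N−1}`), `J ∈ V` the local field at the site (the sum over neighbours entering the
action; fixed during the site update), `c = ε_s · c_map ≥ 0` the step constant.  E–S eq. (17) in
coordinate-free form:

* `tangentKick J x' = J − ⟪J, x'⟫ x'` — the tangential part `p` of `J` at `x'`;
* `geodesicKick c J x' = cos(c‖p‖) x' + (sin(c‖p‖)/‖p‖) p` — the kicked point (`= x'` when
  `p = 0`, by `0/0 = 0`).

## Content (`‖x'‖ = 1` throughout; `θ' = angle J x'`, `κ = c ‖J‖`)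

* `inner_self_tangentKick` (`⟪x', p⟫ = 0`), `norm_tangentKick_sq` (`‖p‖² = ‖J‖² − ⟪J, x'⟫²`),
  `inner_tangentKick` (`⟪J, p⟫ = ‖p‖²`), **`norm_tangentKick`** (`‖p‖ = ‖J‖ sin θ'`, so the arc is
  `α = c‖p‖ = κ sin θ'`), `inner_eq_norm_mul_cos_angle` (`⟪J, x'⟫ = ‖J‖ cos θ'`).
* `tangentKick_map`, **`geodesicKick_map`** — covariance: `geodesicKick c (R J) (R x') =
  R (geodesicKick c J x')` for every linear isometry `R` (global `O(2N) ⊃ U(N)`; the local `U(1)`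
  phase acting on the site and, through the links, on its local field): the LO site update is
  gauge covariant.
* **`norm_geodesicKick`** — `‖geodesicKick c J x'‖ = 1`: the update stays on the sphere (the
  reference implementation's "`|x| = 1` preserved" check).
* **`inner_geodesicKick`** — `⟪J, x⟫ = ‖J‖ cos (kickAngle κ θ')` for the kicked point `x`;
  **`angle_geodesicKick`** — for `|c| ‖J‖ ≤ 1` (and `J ≠ 0`): `angle J x = kickAngle κ θ'`.  THE
  SITE UPDATE MOVES THE POLAR ANGLE (FROM THE LOCAL-FIELD AXIS) BY THE ONE-DIMENSIONAL MAP
  `kickAngle κ` of `KickAngleMap.lean`.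
* **`geodesicKick_meridian`** — writing `J = r • e` (`‖e‖ = 1`, `r = ‖J‖ > 0`), on the meridian
  through a unit equatorial direction `w ⊥ e`:
  `geodesicKick c J (cos θ' e + sin θ' w) = cos (kickAngle κ θ') e + sin (kickAngle κ θ') w` for
  `θ' ∈ (0, π)`: the azimuthal direction `w` is UNTOUCHED — which is why the sphere Jacobian
  reduces to the polar one (`KickAngleJacobian.lean`), the equator's uniform law being a
  spectator; `tangentKick_meridian`, `norm_tangentKick_meridian` (`p = (r sin θ')·(sin θ' e − cos θ' w)`).
* **`es_jacobian_factors`** — the two printed forms of E–S eq. (18) agree: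
  `1 − c⟪J, x'⟫ = 1 − κ cos θ'` and, for `θ' ∈ (0, π)`,
  `cos α − (⟪J, x'⟫/‖p‖) sin α = sin (kickAngle κ θ') / sin θ'`; hence
  `(1 − c⟪J,x'⟫)(cos α − (⟪J,x'⟫/‖p‖) sin α)^m = (1 − κ cos θ')(sin (kickAngle κ θ')/sin θ')^m`
  (`= KickAngleJacobian.kickJac κ m θ'` by `rfl`).
* **`geodesicKick_not_injOn_sphere`** — for `c ‖J‖ > 1` and any unit `u ⊥ J` (so `dim V ≥ 2`)
  there are two DISTINCT unit vectors with the same kicked image (from `KickAngleMap.kickAngle_fold`: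
  start angles `θ₁ ≠ θ₂` on the meridians of `u` and `−u`).  So with the constant printed in E–S
  eq. (16) — twice that of eqs. (15)/(18) — the site map stops being a bijection as soon as
  `ε_s c |J| > 1`, which the cell's census found at 98.8 % of sites at the printed `t_T`
  (CANARY-C8 §4); no Jacobian makes a non-injective map exact.  With `|c|‖J‖ ≤ 1` the map is a
  bijection of the sphere (polar angle: `KickAngleMap.bijOn_kickAngle`; azimuth fixed).

NOT CLAIMED: the sphere's surface measure and the assembled `HasJacobian` on `S^{2N−1}` (the polar
factor is `KickAngleJacobian.hasJacobian_kickAngle`); the U(1) link variables and the sweep over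
sites; anything quantitative about autocorrelations.
-/

noncomputable section

namespace Summit.Ventures.LatticeQCDFlow.Exactness

open Real Set InnerProductGeometry
open scoped InnerProductSpace

variable {V : Type*} [NormedAddCommGroup V] [InnerProductSpace ℝ V]

/-! ## The objects of E–S eq. (17) -/

/-- The tangential part of the local field `J` at the unit vector `x`: `p = J − ⟪J, x⟫ x`
(E–S: `p = (1 − x xᵀ) J`). -/
def tangentKick (J x : V) : V := J - ⟪J, x⟫_ℝ • x

/-- One Euler step of the leading-order flow at one site (E–S eq. (17)) with step constant `c`
(`= ε_s · c_map`): `x ↦ cos(c‖p‖) x + (sin(c‖p‖)/‖p‖) p`, `p = tangentKick J x`; equal to `x` when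
`p = 0` (Lean's `0/0 = 0`). -/
def geodesicKick (c : ℝ) (J x : V) : V :=
  cos (c * ‖tangentKick J x‖) • x + (sin (c * ‖tangentKick J x‖) / ‖tangentKick J x‖) • tangentKick J x

/-! ## The tangential part: orthogonality and length -/

section Tangent

variable (J : V) {x : V}

/-- `⟪x, p⟫ = 0` for `‖x‖ = 1`. -/
theorem inner_self_tangentKick (hx : ‖x‖ = 1) : ⟪x, tangentKick J x⟫_ℝ = 0 := by
  simp only [tangentKick, inner_sub_right, real_inner_smul_right, real_inner_self_eq_norm_sq, hx,
    one_pow, mul_one, real_inner_comm x J, sub_self]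

/-- `‖p‖² = ‖J‖² − ⟪J, x⟫²` for `‖x‖ = 1`. -/
theorem norm_tangentKick_sq (hx : ‖x‖ = 1) : ‖tangentKick J x‖ ^ 2 = ‖J‖ ^ 2 - ⟪J, x⟫_ℝ ^ 2 := by
  simp only [tangentKick, norm_sub_sq_real, real_inner_smul_right, norm_smul, hx, mul_one,
    Real.norm_eq_abs, sq_abs]
  ring

/-- `⟪J, p⟫ = ‖p‖²` for `‖x‖ = 1`. -/
theorem inner_tangentKick (hx : ‖x‖ = 1) : ⟪J, tangentKick J x⟫_ℝ = ‖tangentKick J x‖ ^ 2 := by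
  rw [norm_tangentKick_sq J hx]
  simp only [tangentKick, inner_sub_right, real_inner_smul_right, real_inner_self_eq_norm_sq]
  ring

/-- `⟪J, x⟫ = ‖J‖ cos θ'`, `θ' = angle J x`, for `‖x‖ = 1`. -/
theorem inner_eq_norm_mul_cos_angle (hx : ‖x‖ = 1) : ⟪J, x⟫_ℝ = ‖J‖ * cos (angle J x) := by
  have h := cos_angle_mul_norm_mul_norm J x
  rw [hx, mul_one] at h
  rw [← h, mul_comm]

/-- **`‖p‖ = ‖J‖ sin θ'`** (`θ' = angle J x`, `‖x‖ = 1`): the arc of the kick is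
`α = c‖p‖ = κ sin θ'` with `κ = c‖J‖`. -/
theorem norm_tangentKick (hx : ‖x‖ = 1) : ‖tangentKick J x‖ = ‖J‖ * sin (angle J x) := by
  have h := sin_angle_mul_norm_mul_norm J x
  rw [hx, mul_one, real_inner_self_eq_norm_sq, real_inner_self_eq_norm_sq, hx, one_pow, mul_one,
    ← sq, ← norm_tangentKick_sq J hx, Real.sqrt_sq (norm_nonneg _)] at h
  rw [← h, mul_comm]

/-- The arc: `c ‖p‖ = (c‖J‖) · sin θ'`. -/
theorem arc_eq (c : ℝ) (hx : ‖x‖ = 1) :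
    c * ‖tangentKick J x‖ = (c * ‖J‖) * sin (angle J x) := by
  rw [norm_tangentKick J hx, mul_assoc]

/-- `(sin α / ‖p‖) · ‖p‖² = sin α · ‖p‖` including the degenerate case `p = 0` (then `α = 0`). -/
theorem sin_div_norm_mul_norm_sq (c : ℝ) (x : V) :
    sin (c * ‖tangentKick J x‖) / ‖tangentKick J x‖ * ‖tangentKick J x‖ ^ 2 =
      sin (c * ‖tangentKick J x‖) * ‖tangentKick J x‖ := by
  rcases eq_or_ne (‖tangentKick J x‖) 0 with h | h
  · rw [h]; simp
  · field_simp

end Tangent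

/-! ## Covariance: the kick commutes with every linear isometry applied to field AND site -/

section Covariance

variable {V' : Type*} [NormedAddCommGroup V'] [InnerProductSpace ℝ V'] (R : V →ₗᵢ[ℝ] V')

/-- The tangential part is covariant: `p(R J, R x) = R p(J, x)` for a linear isometry `R`. -/
theorem tangentKick_map (J x : V) : tangentKick (R J) (R x) = R (tangentKick J x) := by
  simp only [tangentKick, LinearIsometry.inner_map_map, map_sub, LinearIsometry.map_smul]

/-- **Covariance of the site update** (gauge covariance of the LO map at one site): for every
linear isometry `R` — a global `O(2N) ⊃ U(N)` rotation, or the local `U(1)` phase acting on the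
site variable and, through the links, on its local field alike —
`geodesicKick c (R J) (R x) = R (geodesicKick c J x)`. -/
theorem geodesicKick_map (c : ℝ) (J x : V) :
    geodesicKick c (R J) (R x) = R (geodesicKick c J x) := by
  simp only [geodesicKick, tangentKick_map, LinearIsometry.norm_map, map_add,
    LinearIsometry.map_smul]

end Covariance

/-! ## The kicked point: on the sphere, polar angle moved by `kickAngle κ` -/

section Kick

variable (c : ℝ) (J : V) {x : V}

/-- **The kick stays on the sphere**: `‖geodesicKick c J x‖ = 1` for `‖x‖ = 1`. -/
theorem norm_geodesicKick (hx : ‖x‖ = 1) : ‖geodesicKick c J x‖ = 1 := by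
  set p := tangentKick J x with hp
  set α := c * ‖p‖ with hα
  have horth : ⟪x, p⟫_ℝ = 0 := inner_self_tangentKick J hx
  have hsq : ‖geodesicKick c J x‖ ^ 2 = 1 := by
    have h1 : ‖geodesicKick c J x‖ ^ 2 =
        cos α ^ 2 + (sin α / ‖p‖) ^ 2 * ‖p‖ ^ 2 := by
      rw [geodesicKick, ← hp, ← hα, norm_add_sq_real, norm_smul, norm_smul, hx, mul_one,
        real_inner_smul_left, real_inner_smul_right, horth, Real.norm_eq_abs, Real.norm_eq_abs,
        sq_abs, mul_pow, sq_abs]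
      ring
    have h2 : (sin α / ‖p‖) ^ 2 * ‖p‖ ^ 2 = sin α ^ 2 := by
      rcases eq_or_ne (‖p‖) 0 with h | h
      · have : α = 0 := by rw [hα, h, mul_zero]
        rw [h, this, sin_zero]
        simp
      · field_simp
    rw [h1, h2, cos_sq_add_sin_sq]
  have h0 : 0 ≤ ‖geodesicKick c J x‖ := norm_nonneg _
  nlinarith [hsq, h0]

/-- **The polar angle is moved by `kickAngle`**, cosine form (no condition on `c`):
`⟪J, geodesicKick c J x⟫ = ‖J‖ · cos (kickAngle (c‖J‖) (angle J x))` for `‖x‖ = 1`. -/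
theorem inner_geodesicKick (hx : ‖x‖ = 1) :
    ⟪J, geodesicKick c J x⟫_ℝ = ‖J‖ * cos (kickAngle (c * ‖J‖) (angle J x)) := by
  set p := tangentKick J x with hp
  have h1 : ⟪J, geodesicKick c J x⟫_ℝ =
      cos (c * ‖p‖) * ⟪J, x⟫_ℝ + sin (c * ‖p‖) / ‖p‖ * ‖p‖ ^ 2 := by
    rw [geodesicKick, ← hp, inner_add_right, real_inner_smul_right, real_inner_smul_right,
      inner_tangentKick J hx]
  rw [h1, hp, sin_div_norm_mul_norm_sq J c x, inner_eq_norm_mul_cos_angle J hx,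
    norm_tangentKick J hx, kickAngle_apply, cos_sub]
  ring_nf

/-- **`angle J (geodesicKick c J x) = kickAngle (c‖J‖) (angle J x)`** for `‖x‖ = 1`, `J ≠ 0` and
`|c| ‖J‖ ≤ 1` (then `kickAngle κ θ' ∈ [0, π]` and `arccos ∘ cos` is the identity there): the site
update is the one-dimensional angle map on the polar angle from the local-field axis. -/
theorem angle_geodesicKick (hJ : J ≠ 0) (hc : |c| * ‖J‖ ≤ 1) (hx : ‖x‖ = 1) :
    angle J (geodesicKick c J x) = kickAngle (c * ‖J‖) (angle J x) := by
  have hκ : |c * ‖J‖| ≤ 1 := by rwa [abs_mul, abs_norm]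
  have hmem := kickAngle_mem_Icc hκ ⟨angle_nonneg J x, angle_le_pi J x⟩
  have hJn : ‖J‖ ≠ 0 := norm_ne_zero_iff.2 hJ
  have key : cos (angle J (geodesicKick c J x)) = cos (kickAngle (c * ‖J‖) (angle J x)) := by
    rw [cos_angle, norm_geodesicKick c J hx, mul_one, inner_geodesicKick c J hx,
      mul_div_cancel_left₀ _ hJn]
  exact injOn_cos ⟨angle_nonneg _ _, angle_le_pi _ _⟩ hmem key

end Kick

/-! ## Meridians: the azimuth is untouched -/

section Meridian

variable (c : ℝ) {e w : V} {r : ℝ}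

/-! Here the local field is written `J = r • e` with `‖e‖ = 1`, `r > 0` (`e = Ĵ`, `r = ‖J‖`), and `w`
is a unit vector orthogonal to `e` (an equatorial direction); the meridian of `w` is
`θ ↦ cos θ • e + sin θ • w`. -/

/-- A meridian point is a unit vector … -/
theorem norm_meridian (he : ‖e‖ = 1) (hw : ‖w‖ = 1) (hew : ⟪e, w⟫_ℝ = 0) (θ : ℝ) :
    ‖cos θ • e + sin θ • w‖ = 1 := by
  have hsq : ‖cos θ • e + sin θ • w‖ ^ 2 = 1 := by
    rw [norm_add_sq_real, norm_smul, norm_smul, he, hw, real_inner_smul_left,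
      real_inner_smul_right, hew, Real.norm_eq_abs, Real.norm_eq_abs, mul_one, mul_one, sq_abs,
      sq_abs, mul_zero, mul_zero, mul_zero, add_zero, cos_sq_add_sin_sq]
  have h0 : 0 ≤ ‖cos θ • e + sin θ • w‖ := norm_nonneg _
  nlinarith [hsq, h0]

/-- … so is the direction `sin θ • e − cos θ • w` of its tangential kick … -/
theorem norm_meridian_dir (he : ‖e‖ = 1) (hw : ‖w‖ = 1) (hew : ⟪e, w⟫_ℝ = 0) (θ : ℝ) :
    ‖sin θ • e - cos θ • w‖ = 1 := by
  have hsq : ‖sin θ • e - cos θ • w‖ ^ 2 = 1 := by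
    rw [norm_sub_sq_real, norm_smul, norm_smul, he, hw, real_inner_smul_left,
      real_inner_smul_right, hew, Real.norm_eq_abs, Real.norm_eq_abs, mul_one, mul_one, sq_abs,
      sq_abs, mul_zero, mul_zero, mul_zero, sub_zero, sin_sq_add_cos_sq]
  have h0 : 0 ≤ ‖sin θ • e - cos θ • w‖ := norm_nonneg _
  nlinarith [hsq, h0]

/-- … with `⟪J, ·⟫ = r cos θ` … -/
theorem inner_meridian (he : ‖e‖ = 1) (hew : ⟪e, w⟫_ℝ = 0) (r θ : ℝ) :
    ⟪r • e, cos θ • e + sin θ • w⟫_ℝ = r * cos θ := by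
  rw [inner_add_right, real_inner_smul_right, real_inner_smul_right, real_inner_smul_left,
    real_inner_smul_left, hew, real_inner_self_eq_norm_sq, he]
  ring

/-- … whose tangential part is `(r sin θ) • (sin θ • e − cos θ • w)` … -/
theorem tangentKick_meridian (he : ‖e‖ = 1) (hew : ⟪e, w⟫_ℝ = 0) (r θ : ℝ) :
    tangentKick (r • e) (cos θ • e + sin θ • w) = (r * sin θ) • (sin θ • e - cos θ • w) := by
  rw [tangentKick, inner_meridian he hew r θ]
  have hc : r - r * cos θ * cos θ = r * sin θ * sin θ := by
    linear_combination (-r) * sin_sq_add_cos_sq θ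
  calc r • e - (r * cos θ) • (cos θ • e + sin θ • w)
        = (r - r * cos θ * cos θ) • e - (r * cos θ * sin θ) • w := by module
    _ = (r * sin θ * sin θ) • e - (r * cos θ * sin θ) • w := by rw [hc]
    _ = (r * sin θ) • (sin θ • e - cos θ • w) := by module

/-- … of length `r sin θ` for `θ ∈ [0, π]`, `r ≥ 0`. -/
theorem norm_tangentKick_meridian (he : ‖e‖ = 1) (hw : ‖w‖ = 1) (hew : ⟪e, w⟫_ℝ = 0) (hr : 0 ≤ r)
    {θ : ℝ} (hθ : θ ∈ Icc 0 π) :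
    ‖tangentKick (r • e) (cos θ • e + sin θ • w)‖ = r * sin θ := by
  rw [tangentKick_meridian he hew r θ, norm_smul, norm_meridian_dir he hw hew θ, mul_one,
    Real.norm_eq_abs, abs_of_nonneg (mul_nonneg hr (sin_nonneg_of_nonneg_of_le_pi hθ.1 hθ.2))]

/-- **The azimuth is untouched.**  On the meridian of a unit equatorial direction `w ⊥ e`
(`J = r • e`, `r ≥ 0`), for `θ ∈ (0, π)`:
`geodesicKick c J (cos θ • e + sin θ • w) = cos (kickAngle (c r) θ) • e + sin (kickAngle (c r) θ) • w`
— the kick rotates within the plane `span{e, w}`, towards `e`, by the arc `(c r) sin θ`. -/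
theorem geodesicKick_meridian (he : ‖e‖ = 1) (hw : ‖w‖ = 1) (hew : ⟪e, w⟫_ℝ = 0) (hr : 0 < r)
    {θ : ℝ} (hθ : θ ∈ Ioo 0 π) :
    geodesicKick c (r • e) (cos θ • e + sin θ • w) =
      cos (kickAngle (c * r) θ) • e + sin (kickAngle (c * r) θ) • w := by
  have hs : sin θ ≠ 0 := (sin_pos_of_pos_of_lt_pi hθ.1 hθ.2).ne'
  have hp0 : r * sin θ ≠ 0 := mul_ne_zero hr.ne' hs
  rw [geodesicKick, norm_tangentKick_meridian he hw hew hr.le (Ioo_subset_Icc_self hθ),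
    tangentKick_meridian he hew r θ, smul_smul, div_mul_cancel₀ _ hp0, kickAngle_apply,
    show c * (r * sin θ) = c * r * sin θ by ring, cos_sub, sin_sub]
  module

end Meridian

/-! ## E–S eq. (18): the two printed forms of the Jacobian agree -/

section Jacobian

variable (c : ℝ) (J : V) {x : V}

/-- First factor: `1 − c⟪J, x'⟫ = 1 − κ cos θ'` (`κ = c‖J‖`, `θ' = angle J x'`). -/
theorem es_first_factor (hx : ‖x‖ = 1) :
    1 - c * ⟪J, x⟫_ℝ = 1 - (c * ‖J‖) * cos (angle J x) := by
  rw [inner_eq_norm_mul_cos_angle J hx, mul_assoc]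

/-- Second factor: `cos α − (⟪J, x'⟫/‖p‖) sin α = sin (kickAngle κ θ') / sin θ'` for
`θ' ∈ (0, π)` and `J ≠ 0` (`α = c‖p‖ = κ sin θ'`). -/
theorem es_second_factor (hJ : J ≠ 0) (hx : ‖x‖ = 1) (hθ : angle J x ∈ Ioo 0 π) :
    cos (c * ‖tangentKick J x‖) - ⟪J, x⟫_ℝ / ‖tangentKick J x‖ * sin (c * ‖tangentKick J x‖) =
      sin (kickAngle (c * ‖J‖) (angle J x)) / sin (angle J x) := by
  have hJn : ‖J‖ ≠ 0 := norm_ne_zero_iff.2 hJ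
  have hs : sin (angle J x) ≠ 0 := (sin_pos_of_pos_of_lt_pi hθ.1 hθ.2).ne'
  rw [norm_tangentKick J hx, inner_eq_norm_mul_cos_angle J hx, kickAngle_apply,
    show angle J x - c * ‖J‖ * sin (angle J x) = angle J x - c * (‖J‖ * sin (angle J x)) by ring,
    sin_sub]
  field_simp

/-- **E–S eq. (18), both printed forms**: for `‖x'‖ = 1`, `J ≠ 0`, `θ' = angle J x' ∈ (0, π)` and
every exponent `m` (`= 2N − 2`),
`(1 − c⟪J,x'⟫) · (cos α − (⟪J,x'⟫/‖p‖) sin α)^m = (1 − κ cos θ') · (sin (kickAngle κ θ') / sin θ')^m`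
— the right-hand side is `KickAngleJacobian.kickJac κ m θ'`, the Jacobian of the polar map
against `sin^m θ dθ`. -/
theorem es_jacobian_factors (hJ : J ≠ 0) (hx : ‖x‖ = 1) (hθ : angle J x ∈ Ioo 0 π) (m : ℕ) :
    (1 - c * ⟪J, x⟫_ℝ) *
        (cos (c * ‖tangentKick J x‖) -
          ⟪J, x⟫_ℝ / ‖tangentKick J x‖ * sin (c * ‖tangentKick J x‖)) ^ m =
      (1 - (c * ‖J‖) * cos (angle J x)) *
        (sin (kickAngle (c * ‖J‖) (angle J x)) / sin (angle J x)) ^ m := by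
  rw [es_first_factor c J hx, es_second_factor c J hJ hx hθ]

end Jacobian

/-! ## `κ > 1`: two distinct points of the sphere with the same image -/

section Fold

variable {c : ℝ} {J u : V}

/-- **Non-injectivity past `κ = 1`.**  If `c‖J‖ > 1` and `u` is a unit vector orthogonal to `J`,
there are unit vectors `x₁ ≠ x₂` with `geodesicKick c J x₁ = geodesicKick c J x₂`: by
`KickAngleMap.kickAngle_fold` pick `θ₁ ≠ θ₂` in `(0, π)` with `kickAngle κ θ₂ = −kickAngle κ θ₁`
and take `x₁` on the meridian of `u` at `θ₁`, `x₂` on the meridian of `−u` at `θ₂`. -/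
theorem geodesicKick_not_injOn_sphere (hJ : J ≠ 0) (hu : ‖u‖ = 1) (hJu : ⟪J, u⟫_ℝ = 0)
    (hκ : 1 < c * ‖J‖) :
    ∃ x₁ x₂ : V, ‖x₁‖ = 1 ∧ ‖x₂‖ = 1 ∧ x₁ ≠ x₂ ∧ geodesicKick c J x₁ = geodesicKick c J x₂ := by
  obtain ⟨θ₁, hθ₁, θ₂, hθ₂, _, hfold, _⟩ := kickAngle_fold hκ
  have hJn : ‖J‖ ≠ 0 := norm_ne_zero_iff.2 hJ
  have hr : 0 < ‖J‖ := norm_pos_iff.2 hJ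
  -- `J = ‖J‖ • e` with `e` a unit vector orthogonal to `u`
  set e : V := ‖J‖⁻¹ • J with he_def
  have he : ‖e‖ = 1 := by
    rw [he_def, norm_smul, Real.norm_eq_abs, abs_inv, abs_norm, inv_mul_cancel₀ hJn]
  have hJe : J = ‖J‖ • e := by rw [he_def, smul_smul, mul_inv_cancel₀ hJn, one_smul]
  have heu : ⟪e, u⟫_ℝ = 0 := by rw [he_def, real_inner_smul_left, hJu, mul_zero]
  have hu' : ‖-u‖ = 1 := by rw [norm_neg, hu]
  have heu' : ⟪e, -u⟫_ℝ = 0 := by rw [inner_neg_right, heu, neg_zero]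
  refine ⟨cos θ₁ • e + sin θ₁ • u, cos θ₂ • e + sin θ₂ • (-u),
    norm_meridian he hu heu θ₁, norm_meridian he hu' heu' θ₂, ?_, ?_⟩
  · -- distinct: `⟪·, u⟫` is `sin θ₁ > 0` for the first point and `−sin θ₂ < 0` for the second
    intro h
    have h1 := congrArg (fun v => ⟪v, u⟫_ℝ) h
    simp only [inner_add_left, real_inner_smul_left, heu, mul_zero, zero_add, inner_neg_left,
      real_inner_self_eq_norm_sq, hu, one_pow, mul_one, mul_neg] at h1
    have := sin_pos_of_pos_of_lt_pi hθ₁.1 hθ₁.2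
    have := sin_pos_of_pos_of_lt_pi hθ₂.1 hθ₂.2
    linarith
  · rw [hJe, geodesicKick_meridian c he hu heu hr hθ₁, geodesicKick_meridian c he hu' heu' hr hθ₂,
      hfold, cos_neg, sin_neg, smul_neg, neg_smul, neg_neg]

/-- Hence `geodesicKick c J` is not injective on `V` (let alone a bijection of the sphere) when
`c‖J‖ > 1` and `J` has a unit normal. -/
theorem geodesicKick_not_injective (hJ : J ≠ 0) (hu : ‖u‖ = 1) (hJu : ⟪J, u⟫_ℝ = 0)
    (hκ : 1 < c * ‖J‖) : ¬ Function.Injective (geodesicKick c J) := by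
  obtain ⟨x₁, x₂, _, _, hne, heq⟩ := geodesicKick_not_injOn_sphere hJ hu hJu hκ
  exact fun hinj => hne (hinj heq)

end Fold

end Summit.Ventures.LatticeQCDFlow.Exactness

end
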